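import Mathlib
import Summits.Ventures.HodgeRepro2.Tier7.Line3.DensityTransfer

/-!
# Tier7/Line3/WeakApproximation — the (WA) input of Lemma WA′ in the kernel: weak approximation for a number field at
any finite set of places, into Mathlib's completions

Filer: t7-L1-p3 (gen 4, prover-pub-hodge-repro2-t7-L1-p3-g4-0), TARGET line STATUS l. 15320 (fourth target). Lane: SUPPORT for Line 3's
version-(ii) chain (L3-ARGUMENT.md v13 §2f, the `a_γ₀ ≠ 0` row: Lemma WA′ — Tier7/Line3/DensityTransfer p676334
`dense_of_approximations` takes (WA) «a set `S ⊆ ∏_{v∈T} E_v` is dense» = the field `E` dense in the product of its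
completions at the finite set `T` of places — Neukirch II (3.4), lit-4 C-L4-33); NOT a line, NOT a device.

WHAT IT SUPPLIES. For a number field `K` (Mathlib's `NumberField`) and ANY finite family of DISTINCT places — infinite
(`NumberField.InfinitePlace K`) and finite (`IsDedekindDomain.HeightOneSpectrum (𝓞 K)`, via `NumberField.FinitePlace`) mixed —
the diagonal image of `K` is dense in the product of the corresponding completions:

* (WA0) `denseRange_comp_piMap` — a dense-range map into `∏ X i` followed by componentwise continuous dense-range maps
  `X i → Y i` (the inclusions of `(K, |·|_v)` into the completions `K_v`) has dense range in `∏ Y i`.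
* (WA1) the places are pairwise INEQUIVALENT absolute values (the input Mathlib's abstract theorem needs): `finitePlace_isNontrivial`
  (a finite place is non-trivial), `finitePlace_eq_iff_isEquiv` (two finite places are equal iff equivalent: an element of
  `𝔭₁ ∖ 𝔭₂` has `|x|_{𝔭₁} < 1 = |x|_{𝔭₂}`), `not_isEquiv_infinite_finite` / `not_isEquiv_finite_infinite` (an infinite and a finite
  place are never equivalent: `|2|_∞ = 2 > 1 ≥ |2|_𝔭`); Mathlib already has `InfinitePlace.eq_iff_isEquiv` and `isNontrivial`.
* (WA2) `denseRange_algebraMap_pi_places` — WEAK APPROXIMATION (Neukirch II (3.4)) for any finite family of distinct places,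
  infinite and finite mixed (an injection `p : ι → InfinitePlace K ⊕ FinitePlace K`), at the level of `K` with the place
  topologies (`WithAbs`): Mathlib's abstract theorem `AbsoluteValue.denseRange_algebraMap_pi` + (WA1).
* (WA3) `denseRange_pi_places_of_denseRange` — the same into ANY family of target spaces receiving `(K, |·|_v)` by continuous
  dense-range maps (the completions), by (WA0); `isometry_finitePlace_embedding` / `continuous_finitePlace_embedding` /
  `denseRange_finitePlace_embedding` supply these maps for Mathlib's `v.adicCompletion K` at a finite place (for an infinite place
  Mathlib has `InfinitePlace.Completion.continuous_coe` / `denseRange_coe`).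
* (WA4) `denseRange_pi_completions` — THE (WA) INPUT: for injective families `v : ι₁ → InfinitePlace K`,
  `u : ι₂ → HeightOneSpectrum (𝓞 K)` (`ι₁`, `ι₂` finite), the diagonal map
  `k ↦ ((i ↦ (k : (v i).Completion)), (j ↦ algebraMap K ((u j).adicCompletion K) k))` has dense range in
  `(∏ i, (v i).Completion) × (∏ j, (u j).adicCompletion K)`; `dense_preimage_units_completions` — its restriction to the
  open set of everywhere-non-zero vectors is dense there (the UNITS step `DensityTransfer.dense_preimage_val_pi_of_isOpen`),
  i.e. `K^×` is dense in `∏_{v∈T} K_v^×` for the subspace topology: the (WA) hypothesis of `dense_of_approximations`.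

NOT in this file: the identification of the memo's `E_v`, `E_v^×` with Mathlib's completions and their non-zero elements
(dictionary: the units' group topology = the subspace topology of `K_v ∖ {0}`, inversion being continuous on a normed
field); anything about `X`; nothing about the step (P) is claimed.

§8(d) (uses an L-value-free non-vanishing device): NO — weak approximation.
-/

namespace Summit.Ventures.HodgeRepro2.Tier7.Line3.WeakApproximation

open Function NumberField NumberField.FinitePlace

section Abstract

variable {ι : Type*} {X Y : ι → Type*} [∀ i, TopologicalSpace (X i)] [∀ i, TopologicalSpace (Y i)]

/-- (WA0) A dense-range map into `∏ X i` followed by componentwise continuous dense-range maps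
`e i : X i → Y i` has dense range in `∏ Y i`. -/
theorem denseRange_comp_piMap {A : Type*} {f : A → ∀ i, X i} (hf : DenseRange f)
    (e : ∀ i, X i → Y i) (he : ∀ i, DenseRange (e i)) (hc : ∀ i, Continuous (e i)) :
    DenseRange (fun a i => e i (f a i)) :=
  (DenseRange.piMap he).comp hf (Continuous.piMap hc)

end Abstract

section Places

variable {K : Type*} [Field K] [NumberField K]

/-- (WA1) A finite place is a non-trivial absolute value (a non-zero element of its prime has
absolute value `< 1`). -/
theorem finitePlace_isNontrivial (w : FinitePlace K) : w.1.IsNontrivial := by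
  obtain ⟨x, hx, hx0⟩ := Submodule.exists_mem_ne_zero_of_ne_bot (maximalIdeal w).ne_bot
  refine ⟨algebraMap (𝓞 K) K x, ?_, ?_⟩
  · exact RingOfIntegers.coe_ne_zero_iff.mpr hx0
  · have h := (FinitePlace.norm_lt_one_iff_mem K (maximalIdeal w) x).mpr hx
    rw [FinitePlace.norm_embedding_eq] at h
    exact h.ne

/-- (WA1) Two finite places are equal iff their absolute values are equivalent (for distinct
maximal ideals `𝔭₁ ≠ 𝔭₂` pick `x ∈ 𝔭₁ ∖ 𝔭₂`: `|x|_{𝔭₁} < 1 = |x|_{𝔭₂}`). -/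
theorem finitePlace_eq_iff_isEquiv (w₁ w₂ : FinitePlace K) : w₁ = w₂ ↔ w₁.1.IsEquiv w₂.1 := by
  refine ⟨fun h => h ▸ .rfl, fun h => ?_⟩
  by_contra hne
  have hne' : maximalIdeal w₁ ≠ maximalIdeal w₂ := fun h' =>
    hne (FinitePlace.maximalIdeal_injective h')
  have hmax : (maximalIdeal w₁).asIdeal.IsMaximal :=
    (maximalIdeal w₁).isPrime.isMaximal (maximalIdeal w₁).ne_bot
  have hnle : ¬ (maximalIdeal w₁).asIdeal ≤ (maximalIdeal w₂).asIdeal := fun hle =>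
    hne' (IsDedekindDomain.HeightOneSpectrum.ext
      (hmax.eq_of_le (maximalIdeal w₂).isPrime.ne_top hle))
  obtain ⟨x, hx₁, hx₂⟩ := SetLike.not_le_iff_exists.mp hnle
  have h1 : w₁ (algebraMap (𝓞 K) K x) < 1 := by
    rw [← FinitePlace.norm_embedding_eq]
    exact (FinitePlace.norm_lt_one_iff_mem K (maximalIdeal w₁) x).mpr hx₁
  have h2 : w₂ (algebraMap (𝓞 K) K x) = 1 := by
    rw [← FinitePlace.norm_embedding_eq]
    exact (FinitePlace.norm_eq_one_iff_notMem K (maximalIdeal w₂) x).mpr hx₂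
  have h3 : w₂ (algebraMap (𝓞 K) K x) < 1 := h.lt_one_iff.mp h1
  rw [h2] at h3
  exact lt_irrefl _ h3

/-- (WA1) An infinite place and a finite place are never equivalent (`|2|_∞ = 2`, `|2|_𝔭 ≤ 1`). -/
theorem not_isEquiv_infinite_finite (v : InfinitePlace K) (w : FinitePlace K) :
    ¬ v.1.IsEquiv w.1 := by
  intro h
  have h2 : w (2 : K) ≤ 1 := by
    have := FinitePlace.norm_le_one K (maximalIdeal w) (2 : 𝓞 K)
    rw [FinitePlace.norm_embedding_eq, map_ofNat] at this
    exact this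
  have h3 : v (2 : K) = 2 := by
    have := v.map_natCast 2
    simpa using this
  have h4 : v (2 : K) ≤ 1 := h.le_one_iff.mpr h2
  rw [h3] at h4
  norm_num at h4

/-- (WA1) A finite place and an infinite place are never equivalent. -/
theorem not_isEquiv_finite_infinite (w : FinitePlace K) (v : InfinitePlace K) :
    ¬ w.1.IsEquiv v.1 :=
  fun h => not_isEquiv_infinite_finite v w h.symm

/-- (WA2) WEAK APPROXIMATION AT ANY FINITE SET OF PLACES (Neukirch II (3.4)): for an injective family
`p` of places (infinite and finite mixed), the diagonal map `K → ∏ i, (K, |·|_{p i})` has dense range.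
(Mathlib's abstract `AbsoluteValue.denseRange_algebraMap_pi` + the inequivalence of distinct places.) -/
theorem denseRange_algebraMap_pi_places {ι : Type*} [Finite ι]
    (p : ι → InfinitePlace K ⊕ FinitePlace K) (hp : Injective p) :
    DenseRange (algebraMap K (∀ i, WithAbs (Sum.elim (fun v : InfinitePlace K => v.1)
      (fun w : FinitePlace K => w.1) (p i)))) := by
  refine AbsoluteValue.denseRange_algebraMap_pi ?_ ?_
  · intro i
    rcases hpi : p i with v | w
    · simpa [hpi] using v.isNontrivial
    · simpa [hpi] using finitePlace_isNontrivial w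
  · intro i j hij
    have hne : p i ≠ p j := fun h => hij (hp h)
    rcases hpi : p i with v | w <;> rcases hpj : p j with v' | w' <;>
      simp only [Sum.elim_inl, Sum.elim_inr]
    · rw [hpi, hpj] at hne
      exact fun h => hne (congrArg Sum.inl ((InfinitePlace.eq_iff_isEquiv).mpr h))
    · exact not_isEquiv_infinite_finite v w'
    · exact not_isEquiv_finite_infinite w v'
    · rw [hpi, hpj] at hne
      exact fun h => hne (congrArg Sum.inr ((finitePlace_eq_iff_isEquiv w w').mpr h))

/-- (WA3) Weak approximation into any family of spaces receiving `(K, |·|_{p i})` by continuous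
dense-range maps `e i` (the completions): the diagonal map `k ↦ (i ↦ e i k)` has dense range. -/
theorem denseRange_pi_places_of_denseRange {ι : Type*} [Finite ι]
    (p : ι → InfinitePlace K ⊕ FinitePlace K) (hp : Injective p) {Y : ι → Type*}
    [∀ i, TopologicalSpace (Y i)]
    (e : ∀ i, WithAbs (Sum.elim (fun v : InfinitePlace K => v.1)
      (fun w : FinitePlace K => w.1) (p i)) → Y i)
    (he : ∀ i, DenseRange (e i)) (hc : ∀ i, Continuous (e i)) :
    DenseRange (fun k : K => fun i => e i (algebraMap K _ k)) :=
  denseRange_comp_piMap (denseRange_algebraMap_pi_places p hp) e he hc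

end Places

section FiniteCompletion

variable {K : Type*} [Field K] [NumberField K]

/-- (WA3) The embedding of `(K, |·|_v)` into the `v`-adic completion is an isometry
(`‖embedding v x‖ = |x|_v`). -/
theorem isometry_finitePlace_embedding (v : IsDedekindDomain.HeightOneSpectrum (𝓞 K)) :
    Isometry ((FinitePlace.embedding v).comp (WithAbs.equiv (FinitePlace.mk v).1).toRingHom) :=
  AddMonoidHomClass.isometry_of_norm _ fun x ↦ by
    simp only [RingHom.coe_comp, comp_apply]
    rw [WithAbs.norm_eq_apply_ofAbs]
    rfl

/-- (WA3) The embedding of `(K, |·|_v)` into the `v`-adic completion is continuous. -/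
theorem continuous_finitePlace_embedding (v : IsDedekindDomain.HeightOneSpectrum (𝓞 K)) :
    Continuous (fun x : WithAbs (FinitePlace.mk v).1 =>
      FinitePlace.embedding v (WithAbs.equiv _ x)) :=
  (isometry_finitePlace_embedding v).continuous

/-- (WA3) The embedding of `(K, |·|_v)` into the `v`-adic completion has dense range
(Mathlib's `HeightOneSpectrum.denseRange_algebraMap`). -/
theorem denseRange_finitePlace_embedding (v : IsDedekindDomain.HeightOneSpectrum (𝓞 K)) :
    DenseRange (fun x : WithAbs (FinitePlace.mk v).1 =>
      FinitePlace.embedding v (WithAbs.equiv _ x)) := by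
  have h : (fun x : WithAbs (FinitePlace.mk v).1 => FinitePlace.embedding v (WithAbs.equiv _ x)) =
      (algebraMap K (v.adicCompletion K)) ∘ (WithAbs.equiv (FinitePlace.mk v).1) := by
    funext x
    rfl
  rw [h, DenseRange, (WithAbs.equiv _).surjective.range_comp]
  exact IsDedekindDomain.HeightOneSpectrum.denseRange_algebraMap K v

end FiniteCompletion

section Completions

variable {K : Type*} [Field K] [NumberField K]

/-- (WA0′) Product form of (WA0): a dense-range map into `(∏ i, X₁ i) × (∏ j, X₂ j)` followed by
componentwise continuous dense-range maps has dense range in `(∏ i, Y₁ i) × (∏ j, Y₂ j)`. -/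
theorem denseRange_prod_comp_piMap {ι₁ ι₂ : Type*} {X₁ Y₁ : ι₁ → Type*} {X₂ Y₂ : ι₂ → Type*}
    [∀ i, TopologicalSpace (X₁ i)] [∀ i, TopologicalSpace (Y₁ i)] [∀ j, TopologicalSpace (X₂ j)]
    [∀ j, TopologicalSpace (Y₂ j)] {A : Type*} {f : A → (∀ i, X₁ i) × (∀ j, X₂ j)}
    (hf : DenseRange f) (e₁ : ∀ i, X₁ i → Y₁ i) (he₁ : ∀ i, DenseRange (e₁ i))
    (hc₁ : ∀ i, Continuous (e₁ i)) (e₂ : ∀ j, X₂ j → Y₂ j) (he₂ : ∀ j, DenseRange (e₂ j))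
    (hc₂ : ∀ j, Continuous (e₂ j)) :
    DenseRange (fun a => ((fun i => e₁ i ((f a).1 i)), (fun j => e₂ j ((f a).2 j)))) :=
  ((DenseRange.piMap he₁).prodMap (DenseRange.piMap he₂)).comp hf
    ((Continuous.piMap hc₁).prodMap (Continuous.piMap hc₂))

/-- (WA2′) Weak approximation at a mixed family in PRODUCT form: for injective finite families of
infinite places `v` and of finite places `u`, `k ↦ ((i ↦ k), (j ↦ k))` has dense range in
`(∏ i, (K, |·|_{v i})) × (∏ j, (K, |·|_{u j}))`. -/
theorem denseRange_prod_pi_places {ι₁ ι₂ : Type*} [Finite ι₁] [Finite ι₂]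
    (v : ι₁ → InfinitePlace K) (hv : Injective v)
    (u : ι₂ → IsDedekindDomain.HeightOneSpectrum (𝓞 K)) (hu : Injective u) :
    DenseRange (fun k : K => ((fun i => WithAbs.toAbs (v i).1 k),
      (fun j => WithAbs.toAbs (FinitePlace.mk (u j)).1 k))) := by
  let p : ι₁ ⊕ ι₂ → InfinitePlace K ⊕ FinitePlace K := Sum.map v (fun j => FinitePlace.mk (u j))
  have hp : Injective p := by
    intro a b hab
    rcases a with i | j <;> rcases b with i' | j' <;> simp only [p, Sum.map_inl, Sum.map_inr,
      Sum.inl.injEq, Sum.inr.injEq, reduceCtorEq] at hab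
    · rw [hv hab]
    · rw [hu (FinitePlace.mk_eq_iff.mp hab)]
  have hd := denseRange_algebraMap_pi_places p hp
  let H := Homeomorph.sumPiEquivProdPi ι₁ ι₂ (fun s => WithAbs (Sum.elim
    (fun v : InfinitePlace K => v.1) (fun w : FinitePlace K => w.1) (p s)))
  have hh := H.surjective.denseRange.comp hd H.continuous
  exact hh

/-- (WA4) THE (WA) INPUT INTO MATHLIB'S COMPLETIONS: for injective finite families of infinite
places `v` and of finite places `u`, the diagonal map
`k ↦ ((i ↦ algebraMap K (v i).Completion k), (j ↦ algebraMap K ((u j).adicCompletion K) k))`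
has dense range in `(∏ i, (v i).Completion) × (∏ j, (u j).adicCompletion K)`. -/
theorem denseRange_pi_completions {ι₁ ι₂ : Type*} [Finite ι₁] [Finite ι₂]
    (v : ι₁ → InfinitePlace K) (hv : Injective v)
    (u : ι₂ → IsDedekindDomain.HeightOneSpectrum (𝓞 K)) (hu : Injective u) :
    DenseRange (fun k : K => ((fun i => algebraMap K (v i).Completion k),
      (fun j => algebraMap K ((u j).adicCompletion K) k))) :=
  denseRange_prod_comp_piMap (denseRange_prod_pi_places v hv u hu)
    (fun i => ((↑) : WithAbs (v i).1 → (v i).Completion))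
    (fun i => InfinitePlace.Completion.denseRange_coe (v i))
    (fun i => InfinitePlace.Completion.continuous_coe (v i))
    (fun j => fun x : WithAbs (FinitePlace.mk (u j)).1 => FinitePlace.embedding (u j) (WithAbs.equiv _ x))
    (fun j => denseRange_finitePlace_embedding (u j))
    (fun j => continuous_finitePlace_embedding (u j))

/-- (WA5) THE UNITS STEP: the diagonal image of `K` meets the open set of everywhere-non-zero vectors
of `(∏ i, (v i).Completion) × (∏ j, (u j).adicCompletion K)` in a dense subset of it — «`K^×` is dense in
`∏_{v∈T} K_v^×`», the (WA) hypothesis of `DensityTransfer.dense_of_approximations` in the subspace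
topology (`DensityTransfer.dense_preimage_val_of_isOpen`). -/
theorem dense_preimage_units_completions {ι₁ ι₂ : Type*} [Finite ι₁] [Finite ι₂]
    (v : ι₁ → InfinitePlace K) (hv : Injective v)
    (u : ι₂ → IsDedekindDomain.HeightOneSpectrum (𝓞 K)) (hu : Injective u) :
    Dense ((Subtype.val : ↥((Set.pi Set.univ fun i => {y : (v i).Completion | y ≠ 0}) ×ˢ
        (Set.pi Set.univ fun j => {y : (u j).adicCompletion K | y ≠ 0})) →
        (∀ i, (v i).Completion) × (∀ j, (u j).adicCompletion K)) ⁻¹'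
      Set.range (fun k : K => ((fun i => algebraMap K (v i).Completion k),
        (fun j => algebraMap K ((u j).adicCompletion K) k)))) :=
  DensityTransfer.dense_preimage_val_of_isOpen (denseRange_pi_completions v hv u hu)
    ((isOpen_set_pi Set.finite_univ fun _ _ => isOpen_ne).prod
      (isOpen_set_pi Set.finite_univ fun _ _ => isOpen_ne))

end Completions

end Summit.Ventures.HodgeRepro2.Tier7.Line3.WeakApproximation
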